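import Literature.Analysis.FluidPDE.PeriodicEnergyAxis
import HarnessLib

/-!
# Lei–Ren–Zhang 2019, §§2–3: the tested equation at one time slice, per period

Analysis/FluidPDE proofs file (theorems only, no definitions, no named facts), on the discharge
path of the named fact `Literature.Analysis.FluidPDE.leiRenZhang2019_liouville_periodic`
(Z. Lei, X. Ren, Q. S. Zhang, arXiv:1902.11229 = Math. Ann. 383 (2022), Theorem 1.1). The
energy computations of §§2–3 ((2.4), (3.3), Lemma 3.3: "by direct computations … using
integration by parts") are, at one time slice, the identity
`∫ H'(F) N φ̃² = −∫_{slab}(H''(F)|∇F|²ψ² + H'(F)∇F·∇ψ²) + ∫_{slab} H(F) b·∇ψ²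
  + (∫_{slab}(2/r)H(F)∂ᵣψ² + 2c₂ψ(0)²∫_0^P H(F)|_{r=0} dz)`
for `N = ΔF − b·∇F − (2/r)∂ᵣF`, `div b = 0`, the window cut-off `φ̃ = ψ(x)ω(x₂)` and the slab
`zSlab P 0` (the integrand of `energy_identity_axis_periodic`, WITHOUT the time integration).
It is recorded here per slice so that the time-integrability of the right-hand bracket follows
from that of the tested equation (`integrable_testedEquation_window`, Fubini) — no joint
regularity of the drift `b` in time is needed for the time argument of Lemma 3.1.

* `testedSlice_eq_bracket_periodic`.

## References

* Z. Lei, X. Ren, Q. S. Zhang, arXiv:1902.11229, §2 (2.4), §3 (3.3) (arXiv pp. 5, 7).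
  [LeiRenZhang2019]
-/

noncomputable section

open MeasureTheory Set Function Filter Metric intervalIntegral
open _root_.Topology
open scoped InnerProductSpace RealInnerProductSpace Laplacian

namespace Literature.Analysis.FluidPDE

namespace LeiRenZhang2019

open LeiZhang2011

/-- The support bound of the window: `ω(z) ≠ 0 ⇒ |z| ≤ 2P`. [folklore] -/
private theorem abs_le_of_periodicWindow_ne_zero_pts {P : ℝ} (hP : 0 < P) (z : ℝ)
    (hz : periodicWindow P z ≠ 0) : |z| ≤ 2 * P := by
  have h := mem_Ioo_of_periodicWindow_ne_zero hP hz
  rw [abs_le]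
  exact ⟨by linarith [h.1], h.2.le⟩

set_option maxHeartbeats 800000 in
/-- **The tested equation at one slice, per period** ((2.4)/(3.3) before the time integration):
for `F ∈ C²` axisymmetric and axially `P`-periodic, a `C¹` divergence-free periodic drift `b`,
`N = ΔF − ⟪∇F, b⟫ − (2/r)∂ᵣF`, `H ∈ C²`, and the `z`-independent axisymmetric cut-off `ψ ∈ C²`
(`ψ = 1` on `{r ≤ ρ'}`, `ρ' > 0`, `ψ = 0` on `{r ≥ ρ}`, `∇ψ = a x_h`),
`∫ H'(F) N (ψ ω(x₂))² = −∫_{slab}(H''(F)‖∇F‖²ψ² + H'(F)⟪∇F,∇ψ²⟫) + ∫_{slab} H(F)⟪b,∇ψ²⟫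
  + (∫_{slab}(2/r)H(F)∂ᵣψ² + 2c₂ ψ(0)² ∫_0^P H(F(0,0,z)) dz)`. [cite: LeiRenZhang2019, §2 (2.4) and §3 (3.3) (arXiv pp. 5, 7: testing the equation with the cut-off, integration by parts, ∇·b = 0)] -/
theorem testedSlice_eq_bracket_periodic {P ρ ρ' : ℝ} {F N : EuclideanSpace ℝ (Fin 3) → ℝ}
    {b : EuclideanSpace ℝ (Fin 3) → EuclideanSpace ℝ (Fin 3)} {H : ℝ → ℝ}
    {ψ a : EuclideanSpace ℝ (Fin 3) → ℝ}
    (hP : 0 < P) (hF2 : ContDiff ℝ 2 F) (hFa : IsAxisymmetricScalar F) (hFp : IsAxiallyPeriodic P F)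
    (hb1 : ContDiff ℝ 1 b) (hbdiv : ∀ x, VectorCalculus.divergence b x = 0) (hbp : IsAxiallyPeriodic P b)
    (hN : ∀ x, N x = (Δ F) x - fderiv ℝ F x (b x) - 2 / cylRadius x * fderiv ℝ F x (eR x))
    (hH : ContDiff ℝ 2 H) (hψ : ContDiff ℝ 2 ψ) (hψa : IsAxisymmetricScalar ψ)
    (hψz : ∀ (x : EuclideanSpace ℝ (Fin 3)) (t : ℝ), ψ (x + t • eZ) = ψ x)
    (hρ' : 0 < ρ') (hψ1 : ∀ x, cylRadius x ≤ ρ' → ψ x = 1) (hψ0 : ∀ x, ρ ≤ cylRadius x → ψ x = 0)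
    (ha : Continuous a) (haz : ∀ (x : EuclideanSpace ℝ (Fin 3)) (t : ℝ), a (x + t • eZ) = a x)
    (hψg : ∀ x, gradient ψ x = a x • horizPart x) :
    ∫ x, deriv H (F x) * N x * (ψ x * periodicWindow P (x 2)) ^ 2 =
      -(∫ x in zSlab P 0, (deriv (deriv H) (F x) * ‖gradient F x‖ ^ 2 * ψ x ^ 2 +
          deriv H (F x) * ⟪gradient F x, gradient (fun y => ψ y ^ 2) x⟫)) +
        (∫ x in zSlab P 0, H (F x) * ⟪b x, gradient (fun y => ψ y ^ 2) x⟫) +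
        ((∫ x in zSlab P 0, 2 / cylRadius x * (H (F x) * fderiv ℝ (fun y => ψ y ^ 2) x (eR x))) +
          2 * radialConst₂ * (ψ 0 ^ 2 * ∫ z in (0 : ℝ)..P, H (F (meridianPoint (0, z))))) := by
  -- the window cut-off `φ̃ = ψ ω(x₂)`: `C²`, compactly supported, axisymmetric
  obtain ⟨φt, hφt⟩ : ∃ φt : EuclideanSpace ℝ (Fin 3) → ℝ, φt = fun y => ψ y * periodicWindow P (y 2) :=
    ⟨_, rfl⟩
  have hφt2 : ContDiff ℝ 2 φt := by rw [hφt]; exact contDiff_mul_comp_apply_two hψ (contDiff_periodicWindow P)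
  have hφt1 : ContDiff ℝ 1 φt := hφt2.of_le one_le_two
  have hφtc : HasCompactSupport φt := by
    rw [hφt]
    exact hasCompactSupport_mul_comp_apply_two hψ0 (A := 2 * P) fun z hz =>
      abs_le_of_periodicWindow_ne_zero_pts hP z hz
  have hφta : IsAxisymmetricScalar φt := by rw [hφt]; exact isAxisymmetricScalar_mul_comp_apply_two hψa _
  have hφt2c : HasCompactSupport fun y => φt y ^ 2 := hφtc.comp_left (g := fun t : ℝ => t ^ 2) (by simp)
  have hH1 : ContDiff ℝ 1 H := hH.of_le one_le_two
  -- the three pieces of the tested slice on `ℝ³`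
  set P₁ : EuclideanSpace ℝ (Fin 3) → ℝ := fun x => deriv H (F x) * φt x ^ 2 * (Δ F) x with hP₁
  set P₂ : EuclideanSpace ℝ (Fin 3) → ℝ := fun x => ⟪b x, gradient F x⟫ * (deriv H (F x) * φt x ^ 2) with hP₂
  set P₃ : EuclideanSpace ℝ (Fin 3) → ℝ := fun x =>
    2 / cylRadius x * (fderiv ℝ F x (eR x) * (deriv H (F x) * φt x ^ 2)) with hP₃
  have hHF : Continuous fun x => deriv H (F x) := (hH.continuous_deriv (by norm_num)).comp hF2.continuous
  have hσc : Continuous fun x => deriv H (F x) * φt x ^ 2 := hHF.mul (hφt2.continuous.pow 2)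
  have hσcs : HasCompactSupport fun x => deriv H (F x) * φt x ^ 2 := hφt2c.mul_left
  have hΔc : Continuous (Δ F) := by
    have h2 : ContDiff ℝ ((0 : ℕ∞) + 2 : ℕ∞) F := by simpa using hF2
    exact (contDiff_laplacian (n := 0) h2).continuous
  have hiP₁ : Integrable P₁ (volume : Measure (EuclideanSpace ℝ (Fin 3))) :=
    (hσc.mul hΔc).integrable_of_hasCompactSupport hσcs.mul_right
  have hgradF : Continuous (gradient F) := continuous_gradient_of_contDiff (hF2.of_le one_le_two)
  have hiP₂ : Integrable P₂ (volume : Measure (EuclideanSpace ℝ (Fin 3))) :=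
    ((hb1.continuous.inner hgradF).mul hσc).integrable_of_hasCompactSupport hσcs.mul_left
  obtain ⟨hiP₃, -, e₃⟩ := integral_axis_term_eq_sub_boundary (hF2.of_le one_le_two) hFa hH1 hφt1 hφtc hφta
  -- pointwise: the integrand is `P₁ − P₂ − P₃`
  have hpt : ∀ x, deriv H (F x) * N x * (ψ x * periodicWindow P (x 2)) ^ 2 = P₁ x - P₂ x - P₃ x := by
    intro x
    have e : (ψ x * periodicWindow P (x 2)) ^ 2 = φt x ^ 2 := by rw [hφt]
    simp only [hP₁, hP₂, hP₃, hN x, ← inner_gradient_left F x (b x), real_inner_comm (b x), e]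
    ring
  simp_rw [hpt]
  rw [integral_sub (hiP₁.sub' hiP₂) hiP₃, integral_sub hiP₁ hiP₂]
  have e₁ : ∫ x, P₁ x = -∫ x, (deriv (deriv H) (F x) * ‖gradient F x‖ ^ 2 * φt x ^ 2 +
      deriv H (F x) * ⟪gradient F x, gradient (fun y => φt y ^ 2) x⟫) :=
    integral_laplacian_mul_deriv_comp_mul_sq hF2 hH hφt1 hφtc
  have e₂ : ∫ x, P₂ x = -∫ x, H (F x) * ⟪b x, gradient (fun y => φt y ^ 2) x⟫ :=
    integral_inner_gradient_mul_deriv_comp_mul_sq_divFree hb1 hbdiv hF2 hH hφt2 hφtc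
  rw [e₁, e₂, e₃]
  -- the window reductions, term by term
  have hV := viscous_window_eq hP hF2 hFp hH hψ hψz hψ0
  have hD := drift_window_eq hP hF2 hFp hb1.continuous hbp hH hψ hψz hψ0
  have hA := axis_window_eq hP hF2 hFp hH hψ hψz hρ' hψ1 hψ0 ha haz hψg
  have hB := axisBoundary_window_eq (H := H) hP hF2.continuous hFp hH.continuous hψz
  simp only [hφt]
  rw [hV, hD, hA, hB]
  ring

end LeiRenZhang2019

end Literature.Analysis.FluidPDE

end
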